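import Summits.MatrixMultiplication.OmegaCensus.DominoZ5LineTables
import HarnessLib

/-!
# Enumeration kit for multisets on `ZMod 5 × ZMod 5`: every multiset of size `3` or `4` has a certified line projection

ω-census `pub-omega`, family (b3), seat pub-omega-group gen 19.  Framing: lottery ticket; floor = certified bounds/negative
ranges.  VALUE: the finite kernel computation behind the `ℤ₅ × ℤ₅` domino cell theorems (`DominoZ5Z5Cells.lean`); NOT
progress on ω.

A multiset `F` of size `d` on `ZMod 5 × ZMod 5` is coded by its `25` values `g i = F (pt i)`, `pt i = (i / 5, i % 5)`.  For each
of the six line directions `w_j ∈ {(1,0), (0,1), (1,1), (1,2), (1,3), (1,4)}` (`lineMap`, `dir`, value table `pv`) the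
projection `v ↦ Σ_{⟨w_j,u⟩ = v} F u` is computed from the value list (`cntZ`, packed base `d+1` by `codeZ`), and looked up in
the bit mask of the certified table (`mask3`, `mask4` from `DominoZ5LineTables.table3/4`; `mask3_sound`, `mask4_sound` by
`decide`).  `allVecs n d f` runs `f` over every list of `n` naturals with sum `d` (`allVecs_spec`), and the kernel
computations `cover3`, `cover4` (`2 925` / `20 475` value lists) give `exists_table_entry_three/four`: **every
`F : ZMod 5 × ZMod 5 → ℕ` with `Σ F = 3` (resp. `4`) has a direction `j < 6` and a table entry whose count vector is the
line projection of `F`.**  (Exploration and an independent numerical check of the same statement: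
`pub-omega-group-g19/code/cover2d.py`.)
-/

namespace Summit.MatrixMultiplication.OmegaCensus

open Finset

namespace Z5Z5Domino

/-! ## Directions, points, projection values -/

/-- First coordinate of direction `j`: `(1,0), (0,1), (1,1), (1,2), (1,3), (1,4)`. [folklore] -/
def dirFst (j : ℕ) : ℕ := if j = 1 then 0 else 1

/-- Second coordinate of direction `j`. [folklore] -/
def dirSnd (j : ℕ) : ℕ := if j = 0 then 0 else if j = 1 then 1 else j - 1

/-- The line map `u ↦ a·u₁ + b·u₂` on `ZMod q × ZMod q`, an additive homomorphism. [folklore] -/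
def lineMap {q : ℕ} (a b : ZMod q) : ZMod q × ZMod q →+ ZMod q where
  toFun u := a * u.1 + b * u.2
  map_zero' := by simp
  map_add' x y := by simp only [Prod.fst_add, Prod.snd_add]; ring

/-- The line map of direction `j < 6` on `ZMod 5 × ZMod 5`. [folklore] -/
def lineMapDir (j : ℕ) : ZMod 5 × ZMod 5 →+ ZMod 5 := lineMap ((dirFst j : ℕ) : ZMod 5) ((dirSnd j : ℕ) : ZMod 5)

/-- The point of `ZMod 5 × ZMod 5` with number `i < 25`: `(i / 5, i % 5)`. [folklore] -/
def pt (i : ℕ) : ZMod 5 × ZMod 5 := (((i / 5 : ℕ) : ZMod 5), ((i % 5 : ℕ) : ZMod 5))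

/-- The inverse numbering. [folklore] -/
def ptIdx (u : ZMod 5 × ZMod 5) : ℕ := 5 * u.1.val + u.2.val

/-- `ptIdx` lands below `25`. [folklore] -/
theorem ptIdx_lt (u : ZMod 5 × ZMod 5) : ptIdx u < 25 := by
  unfold ptIdx
  have h1 := u.1.val_lt; have h2 := u.2.val_lt
  omega

/-- `pt ∘ ptIdx = id`. [folklore] -/
theorem pt_ptIdx : ∀ u : ZMod 5 × ZMod 5, pt (ptIdx u) = u := by decide

/-- `ptIdx ∘ pt = id` below `25`. [folklore] -/
theorem ptIdx_pt : ∀ i < 25, ptIdx (pt i) = i := by decide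

/-- The numbering of `ZMod 5 × ZMod 5` by `Fin 25`. [folklore] -/
def ptEquiv : Fin 25 ≃ ZMod 5 × ZMod 5 where
  toFun i := pt i.val
  invFun u := ⟨ptIdx u, ptIdx_lt u⟩
  left_inv i := Fin.ext (ptIdx_pt i.val i.isLt)
  right_inv u := pt_ptIdx u

/-- Projection value of point `i` in direction `j`, computed in `ℕ`. [folklore] -/
def pv (j i : ℕ) : ℕ := (dirFst j * (i / 5) + dirSnd j * (i % 5)) % 5

/-- `pv` is a residue. [folklore] -/
theorem pv_lt (j i : ℕ) : pv j i < 5 := Nat.mod_lt _ (by norm_num)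

/-- `pv` computes the line map. [folklore] -/
theorem pv_spec : ∀ j < 6, ∀ i < 25, (lineMapDir j (pt i)).val = pv j i := by decide

/-- The list of projection values of the `25` points in direction `j` (literal lists for fast kernel evaluation).
[folklore] -/
def pvList (j : ℕ) : List ℕ :=
  match j with
  | 0 => [0,0,0,0,0, 1,1,1,1,1, 2,2,2,2,2, 3,3,3,3,3, 4,4,4,4,4]
  | 1 => [0,1,2,3,4, 0,1,2,3,4, 0,1,2,3,4, 0,1,2,3,4, 0,1,2,3,4]
  | 2 => [0,1,2,3,4, 1,2,3,4,0, 2,3,4,0,1, 3,4,0,1,2, 4,0,1,2,3]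
  | 3 => [0,2,4,1,3, 1,3,0,2,4, 2,4,1,3,0, 3,0,2,4,1, 4,1,3,0,2]
  | 4 => [0,3,1,4,2, 1,4,2,0,3, 2,0,3,1,4, 3,1,4,2,0, 4,2,0,3,1]
  | _ => [0,4,3,2,1, 1,0,4,3,2, 2,1,0,4,3, 3,2,1,0,4, 4,3,2,1,0]

/-- The literal lists agree with `pv`. [folklore] -/
theorem pvList_eq : ∀ j < 6, pvList j = (List.range 25).map (pv j) := by decide

/-! ## Counting along a value list -/

/-- `pick v b a = a` if `b = v`, else `0`. [folklore] -/
def pick (v b a : ℕ) : ℕ := if b = v then a else 0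

/-- `pick` is bounded by its last argument. [folklore] -/
theorem pick_le (v b a : ℕ) : pick v b a ≤ a := by unfold pick; split_ifs <;> omega

/-- `cntZ v l m = Σ_{i : m[i] = v} l[i]` (zipped recursion). [folklore] -/
def cntZ (v : ℕ) : List ℕ → List ℕ → ℕ
  | a :: l, b :: m => pick v b a + cntZ v l m
  | _, _ => 0

/-- `codeZ B l m = Σ_i l[i]·B^(4 − m[i])` (the base-`B` packing of the five counts). [folklore] -/
def codeZ (B : ℕ) : List ℕ → List ℕ → ℕ
  | a :: l, b :: m => a * B ^ (4 - b) + codeZ B l m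
  | _, _ => 0

/-- Horner packing of five digits. [folklore] -/
def horner5 (B c₀ c₁ c₂ c₃ c₄ : ℕ) : ℕ := (((c₀ * B + c₁) * B + c₂) * B + c₃) * B + c₄

/-- A count is at most the total. [folklore] -/
theorem cntZ_le_sum (v : ℕ) : ∀ l m : List ℕ, cntZ v l m ≤ l.sum
  | [], _ => by cases ‹List ℕ› <;> simp [cntZ]
  | a :: l, [] => by simp [cntZ]
  | a :: l, b :: m => by
    simp only [cntZ, List.sum_cons]
    have := cntZ_le_sum v l m
    have := pick_le v b a
    omega

/-- `codeZ` packs the five counts (entries of `m` below `5`). [folklore] -/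
theorem codeZ_eq (B : ℕ) : ∀ l m : List ℕ, (∀ b ∈ m, b < 5) →
    codeZ B l m = horner5 B (cntZ 0 l m) (cntZ 1 l m) (cntZ 2 l m) (cntZ 3 l m) (cntZ 4 l m)
  | [], m, _ => by cases m <;> simp [codeZ, cntZ, horner5]
  | a :: l, [], _ => by simp [codeZ, cntZ, horner5]
  | a :: l, b :: m, hm => by
    have hb : b < 5 := hm b (by simp)
    have ih := codeZ_eq B l m fun x hx => hm x (by simp [hx])
    simp only [codeZ, cntZ, ih, horner5, pick]
    interval_cases b <;> simp <;> ring

/-- `cntZ` on a value list `List.ofFn g` is a finite sum. [folklore] -/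
theorem cntZ_ofFn (v : ℕ) (q : ℕ → ℕ) : ∀ (n : ℕ) (g : Fin n → ℕ) (k : ℕ),
    cntZ v (List.ofFn g) ((List.range' k n).map q) = ∑ i : Fin n, pick v (q (k + i.val)) (g i)
  | 0, g, k => by simp [cntZ]
  | n + 1, g, k => by
    rw [List.ofFn_succ, List.range'_succ, List.map_cons, cntZ, Fin.sum_univ_succ, cntZ_ofFn v q n _ (k + 1)]
    simp only [Fin.val_zero, add_zero, Fin.val_succ]
    congr 1
    refine Fintype.sum_congr _ _ fun i => ?_
    rw [show k + 1 + (i : ℕ) = k + ((i : ℕ) + 1) by omega]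

/-- The case `k = 0`, `n = 25`, with `List.range`. [folklore] -/
theorem cntZ_ofFn_range (v : ℕ) (q : ℕ → ℕ) (g : Fin 25 → ℕ) :
    cntZ v (List.ofFn g) ((List.range 25).map q) = ∑ i : Fin 25, pick v (q i.val) (g i) := by
  rw [List.range_eq_range', cntZ_ofFn v q 25 g 0]
  simp only [zero_add]

/-! ## The check, the enumerator, the masks -/

/-- The per-list check: some direction's packed projection is flagged in `mask`. [folklore] -/
def chk (B mask : ℕ) (l : List ℕ) : Bool := (List.range 6).any fun j => mask.testBit (codeZ B l (pvList j))

/-- Run `f` on every list of `n` naturals with sum `d`. [folklore] -/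
def allVecs : ℕ → ℕ → (List ℕ → Bool) → Bool
  | 0, d, f => if d = 0 then f [] else true
  | n + 1, d, f => (List.range (d + 1)).all fun c => allVecs n (d - c) fun l => f (c :: l)

/-- **Specification of the enumerator.** [folklore] -/
theorem allVecs_spec : ∀ (n d : ℕ) (f : List ℕ → Bool), allVecs n d f = true →
    ∀ l : List ℕ, l.length = n → l.sum = d → f l = true
  | 0, d, f, h, l, hl, hs => by
    have hl' : l = [] := List.eq_nil_of_length_eq_zero hl
    subst hl'
    simp only [List.sum_nil] at hs
    subst hs
    simpa [allVecs] using h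
  | n + 1, d, f, h, l, hl, hs => by
    obtain ⟨c, l', rfl⟩ := List.exists_cons_of_length_eq_add_one hl
    simp only [List.length_cons, Nat.add_right_cancel_iff] at hl
    simp only [List.sum_cons] at hs
    simp only [allVecs, List.all_eq_true, List.mem_range] at h
    have hc : c < d + 1 := by omega
    have h' := h c hc
    exact allVecs_spec n (d - c) (fun l => f (c :: l)) h' l' hl (by omega)

/-- Bit mask of the packed count vectors of a table. [folklore] -/
def mkMask (B : ℕ) (T : List (List ℕ × List (ℕ × List ℕ))) : ℕ :=
  T.foldr (fun e acc => acc ||| 2 ^ horner5 B (e.1.getD 0 0) (e.1.getD 1 0) (e.1.getD 2 0) (e.1.getD 3 0) (e.1.getD 4 0)) 0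

/-- Mask of `table3` (base `4`). [folklore] -/
def mask3 : ℕ := mkMask 4 table3

/-- Mask of `table4` (base `5`). [folklore] -/
def mask4 : ℕ := mkMask 5 table4

/-- Mask soundness for `table3`, packed form (kernel check over all `k < 4⁵`). [folklore] -/
theorem mask3_sound_packed : ∀ k < 1024, mask3.testBit k = true →
    ∃ e ∈ table3, e.1 = [k / 256, k / 64 % 4, k / 16 % 4, k / 4 % 4, k % 4] := by
  decide +kernel

/-- Mask soundness for `table4`, packed form (kernel check over all `k < 5⁵`). [folklore] -/
theorem mask4_sound_packed : ∀ k < 3125, mask4.testBit k = true →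
    ∃ e ∈ table4, e.1 = [k / 625, k / 125 % 5, k / 25 % 5, k / 5 % 5, k % 5] := by
  decide +kernel

/-- Every flagged packed vector with digits `< 4` is the count vector of an entry of `table3`. [folklore] -/
theorem mask3_sound : ∀ c₀ < 3 + 1, ∀ c₁ < 3 + 1, ∀ c₂ < 3 + 1, ∀ c₃ < 3 + 1, ∀ c₄ < 3 + 1,
    mask3.testBit (horner5 (3 + 1) c₀ c₁ c₂ c₃ c₄) = true → ∃ e ∈ table3, e.1 = [c₀, c₁, c₂, c₃, c₄] := by
  intro c₀ h₀ c₁ h₁ c₂ h₂ c₃ h₃ c₄ h₄ hbit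
  obtain ⟨e, he, he1⟩ := mask3_sound_packed (horner5 (3 + 1) c₀ c₁ c₂ c₃ c₄) (by unfold horner5; omega) hbit
  refine ⟨e, he, ?_⟩
  rw [he1]; unfold horner5
  simp only [List.cons.injEq, and_true]
  omega

/-- Every flagged packed vector with digits `< 5` is the count vector of an entry of `table4`. [folklore] -/
theorem mask4_sound : ∀ c₀ < 4 + 1, ∀ c₁ < 4 + 1, ∀ c₂ < 4 + 1, ∀ c₃ < 4 + 1, ∀ c₄ < 4 + 1,
    mask4.testBit (horner5 (4 + 1) c₀ c₁ c₂ c₃ c₄) = true → ∃ e ∈ table4, e.1 = [c₀, c₁, c₂, c₃, c₄] := by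
  intro c₀ h₀ c₁ h₁ c₂ h₂ c₃ h₃ c₄ h₄ hbit
  obtain ⟨e, he, he1⟩ := mask4_sound_packed (horner5 (4 + 1) c₀ c₁ c₂ c₃ c₄) (by unfold horner5; omega) hbit
  refine ⟨e, he, ?_⟩
  rw [he1]; unfold horner5
  simp only [List.cons.injEq, and_true]
  omega

/-- **Kernel enumeration, `d = 3`** (`2 925` value lists). [folklore] -/
theorem cover3 : allVecs 25 3 (chk (3 + 1) mask3) = true := by decide +kernel

/-- **Kernel enumeration, `d = 4`** (`20 475` value lists). [folklore] -/
theorem cover4 : allVecs 25 4 (chk (4 + 1) mask4) = true := by decide +kernel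

/-! ## Semantic form -/

/-- From a successful check to a table entry: generic in the table. [folklore] -/
theorem exists_entry_of_chk {d : ℕ} {T : List (List ℕ × List (ℕ × List ℕ))} {mask : ℕ}
    (hmask : ∀ c₀ < d + 1, ∀ c₁ < d + 1, ∀ c₂ < d + 1, ∀ c₃ < d + 1, ∀ c₄ < d + 1,
      mask.testBit (horner5 (d + 1) c₀ c₁ c₂ c₃ c₄) = true → ∃ e ∈ T, e.1 = [c₀, c₁, c₂, c₃, c₄])
    (g : Fin 25 → ℕ) (hg : ∑ i, g i = d) (h : chk (d + 1) mask (List.ofFn g) = true) :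
    ∃ j < 6, ∃ e ∈ T, ∀ v < 5, e.1.getD v 0 = ∑ i : Fin 25, pick v (pv j i.val) (g i) := by
  simp only [chk, List.any_eq_true, List.mem_range] at h
  obtain ⟨j, hj, hbit⟩ := h
  have hsum : (List.ofFn g).sum = d := by rw [List.sum_ofFn, hg]
  have hpv : ∀ b ∈ pvList j, b < 5 := by
    rw [pvList_eq j hj]; intro b hb
    obtain ⟨i, -, rfl⟩ := List.mem_map.1 hb
    exact pv_lt j i
  rw [codeZ_eq _ _ _ hpv] at hbit
  have hlt : ∀ v, cntZ v (List.ofFn g) (pvList j) < d + 1 := fun v =>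
    lt_of_le_of_lt (cntZ_le_sum v _ _) (by rw [hsum]; exact Nat.lt_succ_self d)
  obtain ⟨e, he, he1⟩ := hmask _ (hlt 0) _ (hlt 1) _ (hlt 2) _ (hlt 3) _ (hlt 4) hbit
  refine ⟨j, hj, e, he, fun v hv => ?_⟩
  rw [← cntZ_ofFn_range v (pv j) g, ← pvList_eq j hj, he1]
  interval_cases v <;> rfl

/-- **Every multiset of size `3` on `ZMod 5 × ZMod 5` (as `25` values) has a certified line projection.** [folklore] -/
theorem exists_table_entry_three (g : Fin 25 → ℕ) (hg : ∑ i, g i = 3) :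
    ∃ j < 6, ∃ e ∈ table3, ∀ v < 5, e.1.getD v 0 = ∑ i : Fin 25, pick v (pv j i.val) (g i) :=
  exists_entry_of_chk (d := 3) mask3_sound g hg
    (allVecs_spec 25 3 _ cover3 (List.ofFn g) (List.length_ofFn) (by rw [List.sum_ofFn, hg]))

/-- **Every multiset of size `4` on `ZMod 5 × ZMod 5` (as `25` values) has a certified line projection.** [folklore] -/
theorem exists_table_entry_four (g : Fin 25 → ℕ) (hg : ∑ i, g i = 4) :
    ∃ j < 6, ∃ e ∈ table4, ∀ v < 5, e.1.getD v 0 = ∑ i : Fin 25, pick v (pv j i.val) (g i) :=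
  exists_entry_of_chk (d := 4) mask4_sound g hg
    (allVecs_spec 25 4 _ cover4 (List.ofFn g) (List.length_ofFn) (by rw [List.sum_ofFn, hg]))

end Z5Z5Domino

end Summit.MatrixMultiplication.OmegaCensus
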